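import Literature.NumberTheory.Automorphic.BCDTModularity
import Literature.NumberTheory.EllipticCurves.KernelReductionTateFormInertiaProofs
import Literature.NumberTheory.EllipticCurves.Isogeny
import Literature.NumberTheory.DiophantineGeometry.LocalReductionProofs
import HarnessLib

/-!
# Crux `FreyModularity` (stmt-ABC-11340), line `Sketch`, stub `stub_absIrrSqrtFive`:
# local lemmas at a (potentially) multiplicative place

Third support file for the stub `stub_absIrrSqrtFive` (Rubin, CSS 1997, Prop. 7), collecting the
model-independent local inputs of its arithmetic half:

* `isTorsionGaloisRep_of_isogeny_bijective` — a framed model of `E[n]` is a framed model of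
  `E'[n]` along a bijective isogeny (used for the global minimal model `C • E`);
* `one_lt_valuation_j_of_hasMultiplicativeReductionAt'` — `ord_v(j(E)) < 0` at a place of
  multiplicative reduction (Silverman, *AEC* VII.5.1(b)), for the place-indexed predicate over
  any Dedekind domain;
* `exists_primesAbove_forall_inertia_card_map_smul_sub_le` — at a place `v ∣ ℓ` (`ℓ` odd) with
  `ord_v(j(E)) < 0`, for EVERY element `τ₀` of the inertia group of a prime of `\bar ℤ` above
  `v`, `#((τ₀² - 1) E[ℓᵐ]) ≤ ℓᵐ` (Serre 1968, IV A.1.2–A.1.3, via the Tate form; the tree's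
  `exists_cyclotomicCharacter_ne_one_card_map_smul_sub_le_of_one_lt_valuation_j` with the
  inertia element left free);
* `exists_ne_zero_smul_eq_of_card_map_le` — if `#((τ - 1) E[5]) ≤ 5` then `τ` fixes a
  non-zero `5`-torsion point.

## References

* [SerreAbelianLadic1968] J.-P. Serre, *Abelian ℓ-adic representations and elliptic curves*
  (1968), Ch. IV, A.1.2–A.1.3.
* [SilvermanAEC2009] J. H. Silverman, *The Arithmetic of Elliptic Curves*, 2nd ed., VII.5.1.
* [RubinCSS1997] K. Rubin, *Modularity of mod 5 representations*, in: G. Cornell,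
  J. H. Silverman, G. Stevens (eds.), *Modular Forms and Fermat's Last Theorem*, Springer (1997),
  Prop. 7 and its proof.
-/

-- `Summit.<Summit>.<Problem>` is the mandated summit-side namespace (CONVENTIONS §2); for the
-- single-conjunct summit `ABC` the two coincide, so the duplicate `ABC.ABC` is deliberate.
set_option linter.dupNamespace false

noncomputable section

open scoped MatrixGroups NumberField

open Matrix Field IsDedekindDomain
open Literature.NumberTheory.EllipticCurves
open Literature.NumberTheory.GaloisRepresentations
open WeierstrassCurve

namespace Summit.ABC.ABC.Theorems

/-! ## Framed models of `E[n]` transport along `ℚ`-isomorphisms -/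

/-- **A framed model of `E[n]` is a framed model of `E'[n]` for a bijective isogeny `E → E'`**
(in particular for the substitution isomorphism `E ≅ C • E` of an admissible change of
variables): the `Γ_K`-equivariant group isomorphism `κ : E(K̄) → E'(K̄)` restricts to a
`Γ_K`-isomorphism `E[n] ≅ E'[n]`, and the frame `E[n] ≃ (ℤ/n)²` composed with its inverse frames
`E'[n]` with the same matrices. [folklore] -/
theorem isTorsionGaloisRep_of_isogeny_bijective {K : Type*} [Field K]
    {W W' : WeierstrassCurve K} (κ : Isogeny W W') (hκ : Function.Bijective κ) {n : ℕ}
    {ρ : FramedGaloisRep K (ZMod n) 2} (h : W.IsTorsionGaloisRep n ρ) :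
    W'.IsTorsionGaloisRep n ρ := by
  -- the restriction `ε : E[n] ≃+ E'[n]`
  -- adapted from `WeierstrassCurve.hasSurjectiveModNGaloisRep_of_isogeny_bijective`
  have hmem : ∀ P : geomTorsion W n, κ (P : W.geomPoints) ∈ geomTorsion W' n := fun P ↦ by
    have hP : (n : ℤ) • (P : W.geomPoints) = 0 := (Submodule.mem_torsionBy_iff (n : ℤ) _).mp P.2
    refine (Submodule.mem_torsionBy_iff (n : ℤ) _).mpr ?_
    rw [← map_zsmul, hP, map_zero]
  let f : geomTorsion W n → geomTorsion W' n := fun P ↦ ⟨κ (P : W.geomPoints), hmem P⟩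
  have hf : Function.Bijective f := by
    constructor
    · intro P Q hPQ
      exact Subtype.ext (hκ.1 (congrArg Subtype.val hPQ))
    · intro Q
      obtain ⟨P, hP⟩ := hκ.2 (Q : W'.geomPoints)
      have hPn : P ∈ geomTorsion W n := by
        refine (Submodule.mem_torsionBy_iff (n : ℤ) _).mpr (hκ.1 ?_)
        have hQ : (n : ℤ) • (Q : W'.geomPoints) = 0 :=
          (Submodule.mem_torsionBy_iff (n : ℤ) _).mp Q.2
        rw [map_zsmul, hP, hQ, map_zero]
      exact ⟨⟨P, hPn⟩, Subtype.ext hP⟩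
  let f' : geomTorsion W n →+ geomTorsion W' n :=
    { toFun := f
      map_zero' := Subtype.ext (map_zero κ)
      map_add' := fun P Q ↦ Subtype.ext (map_add κ (P : W.geomPoints) (Q : W.geomPoints)) }
  let ε : geomTorsion W n ≃+ geomTorsion W' n := AddEquiv.ofBijective f' hf
  have hε : ∀ P : geomTorsion W n,
      ((ε P : geomTorsion W' n) : W'.geomPoints) = κ (P : W.geomPoints) := fun P ↦ rfl
  have hεsmul : ∀ (σ : absoluteGaloisGroup K) (P : geomTorsion W n), ε (σ • P) = σ • ε P := by
    intro σ P
    apply Subtype.ext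
    rw [hε, AddSubgroup.torsionBy.coe_smul, κ.map_smul, AddSubgroup.torsionBy.coe_smul, hε]
  -- compose the frame with `ε⁻¹`
  obtain ⟨e, he⟩ := h
  refine ⟨ε.symm.trans e, fun σ Q ↦ ?_⟩
  have hQ : ε.symm (σ • Q) = σ • ε.symm Q := by
    apply ε.injective
    rw [AddEquiv.apply_symm_apply, hεsmul, AddEquiv.apply_symm_apply]
  rw [AddEquiv.trans_apply, AddEquiv.trans_apply, hQ, he]

/-! ## `ord_v(j) < 0` at a multiplicative place -/

/-- **`|j(E)|_v > 1` at a place of multiplicative reduction** (Silverman, *AEC*, VII.5.1(b): a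
minimal equation at `v` with multiplicative reduction has `v(c₄) = 0 < v(Δ)` and `j Δ = c₄³`).
Stated for the place-indexed predicate `HasMultiplicativeReductionAt v` over any Dedekind domain
`A` with fraction field `K` (the tree's `one_lt_valuation_j_of_hasMultiplicativeReductionAt` is the
case `A = ℤ`). [cite: SilvermanAEC2009, Prop. VII.5.1(b)] -/
theorem one_lt_valuation_j_of_hasMultiplicativeReductionAt' {A : Type*} [CommRing A]
    [IsDedekindDomain A] {K : Type*} [Field K] [Algebra A K] [IsFractionRing A K]
    (v : HeightOneSpectrum A) (W : WeierstrassCurve K) [W.IsElliptic]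
    (hv : W.HasMultiplicativeReductionAt v) : 1 < v.valuation K W.j := by
  -- adapted from `valuation_j_eq_exp_ordMinimalDiscriminant`
  -- (`PastenHeightBoundsLemma68LocalProofs`)
  haveI := W.isElliptic_localMinimalModel v
  set Kv := v.adicCompletion K
  set E := W.localMinimalModel v with hE
  have hm : E.HasMultiplicativeReduction (v.adicCompletionIntegers K) := hv
  -- `j(E) = j(W)` in `K_v`
  have hjE : E.j = algebraMap K Kv W.j := by
    have hC : (((W.baseChange Kv).exists_isMinimal (v.adicCompletionIntegers K)).choose •
        W.baseChange Kv).j = algebraMap K Kv W.j := by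
      rw [variableChange_j]; exact W.map_j _
    exact hC
  have hequiv := WeierstrassCurve.isEquiv_valuation_maximalIdeal_of_le_one_iff
    (WeierstrassCurve.valued_le_one_iff_mem_range_adicCompletionIntegers v (K := K))
  set w := (IsDiscreteValuationRing.maximalIdeal (v.adicCompletionIntegers K)).valuation Kv
    with hw
  -- `j · Δ = c₄³`, `w(c₄) = 1`, `w(Δ) < 1`
  have key : E.j * E.Δ = E.c₄ ^ 3 := by
    rw [WeierstrassCurve.j, ← WeierstrassCurve.coe_Δ', mul_comm, ← mul_assoc, Units.mul_inv,
      one_mul]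
  have hval := congrArg w key
  rw [map_mul, map_pow, hm.multiplicativeReduction, one_pow] at hval
  have hΔ0 : w E.Δ ≠ 0 := by
    intro h0; rw [h0, mul_zero] at hval; exact zero_ne_one hval
  have hwj : 1 < w E.j := by
    rw [eq_inv_of_mul_eq_one_left hval, one_lt_inv₀ (zero_lt_iff.mpr hΔ0)]
    exact hm.badReduction
  rw [← not_le] at hwj ⊢
  intro hle
  apply hwj
  rw [hequiv.le_one_iff_le_one, hjE, WeierstrassCurve.valued_algebraMap_adicCompletion]
  exact hle

/-! ## At a potentially multiplicative place above `ℓ`, `σ² - 1` has small image on `E[ℓᵐ]` for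
every inertia element `σ` -/

open IsDedekindDomain.HeightOneSpectrum in
/-- **At a place `v ∣ ℓ` (`ℓ` odd) with `ord_v(j(E)) < 0`, for every `τ₀` in the inertia group
of (a chosen) prime `𝔓 ∣ v` of `\bar ℤ`, `#((τ₀² - 1) E[ℓᵐ]) ≤ ℓᵐ` for all `m`** (Serre,
*Abelian ℓ-adic representations* (1968), IV, A.1.2–A.1.3: over the Tate curve the `ℓ`-power
torsion is an extension of `ℤ/ℓᵐ` by `μ_{ℓᵐ}`, inertia acting trivially on the quotient).  This is
the tree's `exists_cyclotomicCharacter_ne_one_card_map_smul_sub_le_of_one_lt_valuation_j`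
(`KernelReductionTateFormInertiaProofs`) with the inertia element left free: transport `E(K̄)`
into the Tate form of invariant `j(E)` over `K_v` by the same-`j` isomorphism (a quadratic twist,
intertwining squares), where every isometry moves the `ℓ`-power torsion into the kernel of
reduction, whose subgroups killed by `ℓᵐ` have at most `ℓᵐ` elements.
[cite: SerreAbelianLadic1968, IV A.1.2–A.1.3] -/
theorem exists_primesAbove_forall_inertia_card_map_smul_sub_le {K : Type} [Field K]
    [NumberField K] (W : WeierstrassCurve K) [W.IsElliptic] {v : HeightOneSpectrum (𝓞 K)}
    {ℓ : ℕ} [hℓ : Fact ℓ.Prime] (hℓ2 : ℓ ≠ 2) (hℓv : (ℓ : 𝓞 K) ∈ v.asIdeal)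
    (hj : 1 < v.valuation K W.j) :
    ∃ 𝔓 ∈ v.primesAbove, ∀ τ₀ ∈ 𝔓.inertia (absoluteGaloisGroup K), ∀ m : ℕ,
      Nat.card ((geomTorsion W ((ℓ ^ m : ℕ) : ℤ)).map
        (DistribSMul.toAddMonoidHom (geomPoints W) (τ₀ * τ₀) - AddMonoidHom.id (geomPoints W))) ≤
          ℓ ^ m := by
  -- adapted from `exists_cyclotomicCharacter_ne_one_card_map_smul_sub_le_of_one_lt_valuation_j`
  classical
  obtain ⟨𝔐, h𝔐⟩ := v.localPrimesAbove_nonempty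
  set ι : AlgebraicClosure K →ₐ[K] AlgebraicClosure (v.adicCompletion K) :=
    closureEmb (K := K) (v.adicCompletion K) with hι
  have h𝔓 : v.primeBelow ι 𝔐 ∈ v.primesAbove := HeightOneSpectrum.primeBelow_mem_primesAbove h𝔐
  refine ⟨v.primeBelow ι 𝔐, h𝔓, fun τ₀ hτ₀I m ↦ ?_⟩
  -- a local lift `σ₀` of `τ₀`
  obtain ⟨σ₀, -, hσ₀⟩ :=
    IsDedekindDomain.HeightOneSpectrum.exists_mem_inertia_apply_eq_holds v ι h𝔐 hτ₀I
  have hres₀ : resGalOfEmb ι σ₀ = τ₀ := resGalOfEmb_eq_of_apply_eq ι hσ₀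
  set σ := σ₀ * σ₀ with hσdef
  set τ := resGalOfEmb ι σ with hτdef
  have hτ : τ = τ₀ * τ₀ := by rw [hτdef, hσdef, map_mul, hres₀]
  rw [← hτ]
  -- notation and the Tate form of invariant `j` over `K_v`
  obtain ⟨w, hw⟩ := v.exists_spectralValuation
  set E := v.adicCompletion K
  set L := AlgebraicClosure (v.adicCompletion K)
  have hjw : 1 < w (algebraMap K L W.j) :=
    one_lt_spectralValuation_algebraMap_of_one_lt_valuation hw hj
  obtain ⟨hj0, hj1728, hT, ha₆, -, -⟩ := W.isTateForm_tateFormOfJ_of_one_lt hjw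
  set jv : E := algebraMap K E W.j with hjv
  haveI hTell : (tateFormOfJ jv).IsElliptic := isElliptic_tateFormOfJ hj0 hj1728
  haveI : CharZero E := charZero_of_injective_algebraMap (algebraMap K E).injective
  have hjW : (W.baseChange E).j = jv := W.map_j _
  have hjE : (W.baseChange E).j = (tateFormOfJ jv).j := by
    rw [hjW, tateFormOfJ_j hj0 hj1728]
  have hjE0 : (W.baseChange E).j ≠ 0 := by rw [hjW]; exact hj0
  have hjE1728 : (W.baseChange E).j ≠ 1728 := by rw [hjW]; exact hj1728
  -- the twisting isomorphism, intertwining squares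
  obtain ⟨e, he⟩ := exists_addEquiv_baseChange_of_j_eq_map_algEquiv_sq (W.baseChange E)
    (tateFormOfJ jv) L hjE hjE0 hjE1728
  -- integrality of the Tate form
  haveI hint : ((tateFormOfJ jv).baseChange L).IsIntegral w.integer := by
    refine isIntegral_integer_of_val_le_one ?_ ?_ ?_ (hT.w_a₄_le.trans hT.w_a₆_lt.le)
      hT.w_a₆_lt.le
    · rw [hT.a₁, map_one]
    · rw [hT.a₂, map_zero]; exact zero_le_one
    · rw [hT.a₃, map_zero]; exact zero_le_one
  set σE : L ≃ₐ[E] L := absoluteGaloisGroup.toAlgEquiv _ σ with hσE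
  have hσE' : σE = absoluteGaloisGroup.toAlgEquiv _ σ₀ * absoluteGaloisGroup.toAlgEquiv _ σ₀ := by
    rw [hσE, hσdef, map_mul]
  have hσ₁ : ∀ z : L, w (σE z) = w z := fun z ↦ spectralValuation_smul hw σ z
  -- the transport `Ψ : E(K̄) → T₀(K̄_v)`
  let Φ : localPoints W E ≃+ ((tateFormOfJ jv).baseChange L).toAffine.Point :=
    (Affine.Point.congrEquiv (baseChange_baseChange_adicCompletion W v).symm).trans e
  have hΦ : ∀ Q : localPoints W E, Φ (σ • Q) = Affine.Point.map (σE : L →ₐ[E] L) (Φ Q) := by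
    intro Q
    change e (Affine.Point.congrEquiv (baseChange_baseChange_adicCompletion W v).symm (σ • Q)) =
      Affine.Point.map (σE : L →ₐ[E] L)
        (e (Affine.Point.congrEquiv (baseChange_baseChange_adicCompletion W v).symm Q))
    rw [congrEquiv_smul, ← hσE, hσE']
    exact he _ _
  set Ψ : geomPoints W →+ ((tateFormOfJ jv).baseChange L).toAffine.Point :=
    Φ.toAddMonoidHom.comp (pointsMapOfEmb W ι) with hΨ
  have hΨinj : Function.Injective Ψ := Φ.injective.comp (pointsMapOfEmb_injective W ι)
  have hΨτ : ∀ P : geomPoints W, Ψ (τ • P) = Affine.Point.map (σE : L →ₐ[E] L) (Ψ P) := by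
    intro P
    rw [hΨ, AddMonoidHom.coe_comp, Function.comp_apply, hτdef, pointsMapOfEmb_smul W ι σ P]
    exact hΦ _
  -- the subgroup `(τ - 1) E[ℓᵐ]` and its image `G` in `T₀(K̄_v)`
  set f : geomPoints W →+ geomPoints W :=
    DistribSMul.toAddMonoidHom (geomPoints W) τ - AddMonoidHom.id (geomPoints W) with hf
  have hfapply : ∀ P, f P = τ • P - P := fun P ↦ rfl
  set H := (geomTorsion W ((ℓ ^ m : ℕ) : ℤ)).map f with hH
  have hℓm0 : ((ℓ ^ m : ℕ) : ℤ) ≠ 0 := by exact_mod_cast pow_ne_zero m hℓ.out.ne_zero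
  haveI : Finite (geomTorsion W ((ℓ ^ m : ℕ) : ℤ)) :=
    finite_torsionPoints_holds W (AlgebraicClosure K) hℓm0
  have hHfin : (H : Set (geomPoints W)).Finite := by
    rw [hH, AddSubgroup.coe_map]
    exact (Set.toFinite _).image f
  haveI : Finite H := hHfin.to_subtype
  set G := H.map Ψ with hG
  have hGfin : (G : Set ((tateFormOfJ jv).baseChange L).toAffine.Point).Finite := by
    rw [hG, AddSubgroup.coe_map]
    exact hHfin.image Ψ
  haveI : Finite G := hGfin.to_subtype
  have hcard : Nat.card H = Nat.card G := Nat.card_congr (H.equivMapOfInjective Ψ hΨinj).toEquiv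
  rw [hcard]
  have hℓL : (ℓ : L) ≠ 0 := by
    rw [← map_natCast (algebraMap K L) ℓ]
    exact (map_ne_zero_iff _ (algebraMap K L).injective).mpr (Nat.cast_ne_zero.mpr hℓ.out.ne_zero)
  have hℓw : w (ℓ : L) < 1 := spectralValuation_natCast_lt_one hw hℓv
  refine TateForm.card_addSubgroup_le_pow (tateFormOfJ jv) hT hℓ2 hℓw hℓL m G ?_ ?_
  · -- the affine points of `G` lie in `E₁`
    intro x y h hmem
    obtain ⟨Q, hQ, hQeq⟩ := AddSubgroup.mem_map.mp hmem
    obtain ⟨P, hP, rfl⟩ := AddSubgroup.mem_map.mp hQ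
    have hP0 : ((ℓ ^ m : ℕ) : ℤ) • P = 0 := (Submodule.mem_torsionBy_iff _ P).mp hP
    have hΨP0 : ((ℓ ^ m : ℕ) : ℤ) • Ψ P = 0 := by rw [← map_zsmul, hP0, map_zero]
    rw [hfapply, map_sub, hΨτ] at hQeq
    exact TateForm.one_lt_valuation_of_map_sub_eq_some_of_zsmul_eq_zero (tateFormOfJ jv) hT ha₆
      hℓ2 hℓw σE hσ₁ (Ψ P) hΨP0 hQeq
  · -- `G` is killed by `ℓᵐ`
    intro Q hmem
    obtain ⟨Q', hQ', rfl⟩ := AddSubgroup.mem_map.mp hmem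
    obtain ⟨P, hP, rfl⟩ := AddSubgroup.mem_map.mp hQ'
    have hP0 : ((ℓ ^ m : ℕ) : ℤ) • P = 0 := (Submodule.mem_torsionBy_iff _ P).mp hP
    rw [← map_zsmul Ψ, ← map_zsmul f, hP0, map_zero, map_zero]

/-! ## From a small image of `τ - 1` to a fixed `5`-torsion point -/

/-- If `(τ - 1) E[5]` has at most `5` elements then `τ` fixes a non-zero point of `E[5]`
(`#E[5] = 25`, so `τ - 1` is not injective on `E[5]`). [folklore] -/
theorem exists_ne_zero_smul_eq_of_card_map_le (W : WeierstrassCurve ℚ) [W.IsElliptic]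
    {τ : absoluteGaloisGroup ℚ}
    (h : Nat.card ((geomTorsion W ((5 : ℕ) : ℤ)).map
      (DistribSMul.toAddMonoidHom (geomPoints W) τ - AddMonoidHom.id (geomPoints W))) ≤ 5) :
    ∃ P : geomTorsion W ((5 : ℕ) : ℤ), P ≠ 0 ∧ τ • P = P := by
  classical
  set f := DistribSMul.toAddMonoidHom (geomPoints W) τ - AddMonoidHom.id (geomPoints W) with hf
  set T := geomTorsion W ((5 : ℕ) : ℤ) with hT
  have hcard : Nat.card T = 5 ^ 2 :=
    card_torsionPoints_eq_sq_holds W (AlgebraicClosure ℚ) (n := 5) (by norm_num)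
  haveI : Finite T := Nat.finite_of_card_ne_zero (by rw [hcard]; norm_num)
  have hfin : ((T.map f : AddSubgroup (geomPoints W)) : Set (geomPoints W)).Finite := by
    rw [AddSubgroup.coe_map]
    exact (Set.toFinite _).image f
  haveI : Finite (T.map f) := hfin.to_subtype
  -- the restriction `g : E[5] → (τ - 1) E[5]` is not injective
  let g : T → T.map f := fun P ↦ ⟨f P, AddSubgroup.mem_map_of_mem f P.2⟩
  have hg : ¬ Function.Injective g := by
    intro hinj
    have h1 := Nat.card_le_card_of_injective g hinj
    rw [hcard] at h1
    omega
  obtain ⟨P, Q, hPQ, hne⟩ : ∃ P Q : T, g P = g Q ∧ P ≠ Q := by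
    by_contra hall
    push Not at hall
    exact hg fun P Q hPQ ↦ hall P Q hPQ
  refine ⟨P - Q, sub_ne_zero.mpr hne, Subtype.ext ?_⟩
  have h1 : τ • (P : geomPoints W) - P = τ • (Q : geomPoints W) - Q := congrArg Subtype.val hPQ
  rw [AddSubgroup.torsionBy.coe_smul, AddSubgroupClass.coe_sub, smul_sub]
  exact sub_eq_sub_iff_sub_eq_sub.mp h1


/-- **Registered helper stub (local half at a potentially multiplicative place) toward
`stub_absIrrSqrtFive`**: for an elliptic curve `E/ℚ` with `ord_5(j(E)) < 0` there is a prime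
`𝔓` of `\bar ℤ` above `5` such that the square of every element of its inertia group fixes a
non-zero `5`-torsion point (`exists_primesAbove_forall_inertia_card_map_smul_sub_le` at `m = 1`
and `exists_ne_zero_smul_eq_of_card_map_le`). [cite: SerreAbelianLadic1968, IV A.1.2–A.1.3] -/
theorem stub_absIrrSqrtFive_local :
    ∀ (W : WeierstrassCurve ℚ) [W.IsElliptic] (v : HeightOneSpectrum (𝓞 ℚ)),
      ((5 : ℕ) : 𝓞 ℚ) ∈ v.asIdeal → 1 < v.valuation ℚ W.j →
      ∃ 𝔓 ∈ v.primesAbove, ∀ τ₀ ∈ 𝔓.inertia (absoluteGaloisGroup ℚ),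
        ∃ P : geomTorsion W ((5 : ℕ) : ℤ), P ≠ 0 ∧ (τ₀ * τ₀) • P = P := by
  intro W _ v h5v hj
  obtain ⟨𝔓, h𝔓, hbound⟩ :=
    exists_primesAbove_forall_inertia_card_map_smul_sub_le W (ℓ := 5) (by norm_num) h5v hj
  refine ⟨𝔓, h𝔓, fun τ₀ hτ₀ ↦ ?_⟩
  have hb := hbound τ₀ hτ₀ 1
  rw [pow_one] at hb
  exact exists_ne_zero_smul_eq_of_card_map_le W hb

end Summit.ABC.ABC.Theorems

end
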